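import Literature.MathematicalPhysics.QuantumLattice.SpectralSmoothingProofs
import Mathlib.Analysis.Complex.RealDeriv
import HarnessLib

/-!
# The derivative of a gapped spectral projection is generated by Hastings' operator

Eighth file of the formalisation of the Michalakis–Zwolak stability theorem (hubbard.S19): the
algebraic heart of Hastings' quasi-adiabatic continuation (spectral flow). For the affine path
`H_s = H₀ + sX` of Hermitian matrices and a family of projections `P(s)` that is differentiable at
`s₀`, idempotent and commuting with `H_s` near `s₀`, and equal at `s₀` to the spectral projection of
`H_{s₀}` onto a cluster of eigenvectors separated from the rest of the spectrum by `γ > 0`, the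
derivative is

`P'(s₀) = i [D, P(s₀)]`, `D = ∫ W(t) e^{itH_{s₀}} X e^{−itH_{s₀}} dt`,

for ANY integrable weight `W` with `∫ e^{itΔ} W(t) dt = i/Δ` for `|Δ| ≥ γ`
(`exists_spectralFlowWeight` of `SpectralFlowWeightProofs`). The proof is first-order
perturbation theory on matrix elements: differentiating `H_s P_s = P_s H_s` and `P_s² = P_s`
gives `(Eₖ − Eₗ) P'ₖₗ = (𝟙ₖ − 𝟙ₗ) Xₖₗ` and `P'ₖₗ = 0` for same-side pairs, while the matrix
elements of `D` are `Ŵ(Eₖ − Eₗ) Xₖₗ` (`eigenvector_dotProduct_integral_smul_heisenbergEvolution`),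
`Ŵ(Δ) = i/Δ` across the gap (`hasDerivAt_proj_eq_comm_hastingsGenerator`).

This is the content of Bachmann–Michalakis–Nachtergaele–Sims, CMP **309** (2012) 835 =
arXiv:1102.0842, §2, Proposition 2.4 (`∂_s P(s) = i[D(s), P(s)]` for the generator `D(s)`), as used
by Michalakis–Zwolak §5.2 (arXiv:1109.1588 p. 10: "the unitary `U(s)` satisfies
`U(s) P₀ U†(s) = P₀(s)`"). The differentiability of `s ↦ P(s)` itself (an input here) and the
unitary flow `U(s)` are separate steps. No definitions, no named facts (theorems only).
-/

noncomputable section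

open Matrix Complex NormedSpace MeasureTheory Finset
open scoped Matrix.Norms.L2Operator _root_.Topology

namespace Literature.MathematicalPhysics.QuantumLattice

section ProjDeriv

variable {n : Type*} [Fintype n] [DecidableEq n]

/-- The affine path `s ↦ H₀ + s X` has derivative `X`. [folklore] -/
theorem hasDerivAt_affinePath (H₀ X : Matrix n n ℂ) (s : ℝ) :
    HasDerivAt (fun u : ℝ => H₀ + u • X) X s := by
  have h2 : HasDerivAt (fun u : ℝ => u • X) X s := by
    simpa using (hasDerivAt_id s).smul_const X
  exact h2.const_add H₀

/-- Row action of a Hermitian matrix on an eigen-row: `star uₖ ᵥ* H = Eₖ • star uₖ`. [folklore] -/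
theorem star_eigenvectorBasis_vecMul {H : Matrix n n ℂ} (hH : H.IsHermitian) (k : n) :
    star (hH.eigenvectorBasis k : n → ℂ) ᵥ* H =
      (hH.eigenvalues k : ℂ) • star (hH.eigenvectorBasis k : n → ℂ) := by
  have h1 : star (hH.eigenvectorBasis k : n → ℂ) ᵥ* H = star (Hᴴ *ᵥ (hH.eigenvectorBasis k : n → ℂ)) := by
    rw [star_mulVec, conjTranspose_conjTranspose]
  rw [h1, hH.eq, hH.mulVec_eigenvectorBasis, star_smul, star_trivial,
    RCLike.real_smul_eq_coe_smul (K := ℂ)]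
  rfl

/-- Column action: `H uₗ = Eₗ • uₗ` with a complex scalar. [folklore] -/
theorem mulVec_eigenvectorBasis_coe {H : Matrix n n ℂ} (hH : H.IsHermitian) (l : n) :
    H *ᵥ (hH.eigenvectorBasis l : n → ℂ) = (hH.eigenvalues l : ℂ) • (hH.eigenvectorBasis l : n → ℂ) := by
  rw [hH.mulVec_eigenvectorBasis, RCLike.real_smul_eq_coe_smul (K := ℂ)]
  rfl

/-- Row action of the spectral projection: `star uₖ ᵥ* P_S = 𝟙[k ∈ S] • star uₖ`. [folklore] -/
theorem star_eigenvectorBasis_vecMul_projMatrix {H : Matrix n n ℂ} (hH : H.IsHermitian)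
    (S : Finset n) (k : n) :
    star (hH.eigenvectorBasis k : n → ℂ) ᵥ*
        projMatrix (Submodule.span ℂ (Set.range fun i : S => hH.eigenvectorBasis i)) =
      if k ∈ S then star (hH.eigenvectorBasis k : n → ℂ) else 0 := by
  have hPh := projMatrix_isHermitian (Submodule.span ℂ (Set.range fun i : S => hH.eigenvectorBasis i))
  rw [show star (hH.eigenvectorBasis k : n → ℂ) ᵥ*
      projMatrix (Submodule.span ℂ (Set.range fun i : S => hH.eigenvectorBasis i)) =
        star (projMatrix (Submodule.span ℂ (Set.range fun i : S => hH.eigenvectorBasis i)) *ᵥ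
          (hH.eigenvectorBasis k : n → ℂ)) by rw [star_mulVec, hPh.eq],
    projMatrix_span_mulVec_eigenvectorBasis hH S k]
  split_ifs <;> simp

/-- Matrix elements of `H v` against an eigen-row: `star uₖ ⬝ᵥ (H v) = Eₖ (star uₖ ⬝ᵥ v)`.
[folklore] -/
theorem eigenvector_dotProduct_mulVec_self {H : Matrix n n ℂ} (hH : H.IsHermitian) (k : n)
    (v : n → ℂ) :
    star (hH.eigenvectorBasis k : n → ℂ) ⬝ᵥ (H *ᵥ v) =
      (hH.eigenvalues k : ℂ) * (star (hH.eigenvectorBasis k : n → ℂ) ⬝ᵥ v) := by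
  rw [dotProduct_mulVec, star_eigenvectorBasis_vecMul hH k, smul_dotProduct, smul_eq_mul]

/-- Matrix elements of `P_S v` against an eigen-row: `star uₖ ⬝ᵥ (P_S v) = 𝟙[k ∈ S] (star uₖ ⬝ᵥ v)`.
[folklore] -/
theorem eigenvector_dotProduct_projMatrix_mulVec {H : Matrix n n ℂ} (hH : H.IsHermitian)
    (S : Finset n) (k : n) (v : n → ℂ) :
    star (hH.eigenvectorBasis k : n → ℂ) ⬝ᵥ
        (projMatrix (Submodule.span ℂ (Set.range fun i : S => hH.eigenvectorBasis i)) *ᵥ v) =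
      if k ∈ S then star (hH.eigenvectorBasis k : n → ℂ) ⬝ᵥ v else 0 := by
  rw [dotProduct_mulVec, star_eigenvectorBasis_vecMul_projMatrix hH S k]
  split_ifs
  · rfl
  · exact zero_dotProduct _

/-- **The derivative of a gapped spectral projection is generated by Hastings' operator**
(first-order perturbation theory + the spectral identity of the weight `W`). Let `H_s = H₀ + sX` (`s` real)
with `H₀`, `X` Hermitian, and let `P : ℝ → Matrix` be differentiable at `s₀` with derivative
`P'`, idempotent and commuting with `H_s` for `s` near `s₀`, and equal at `s₀` to the spectral
projection of `H_{s₀}` onto the eigenvectors `uₖ`, `k ∈ S`, where the cluster `S` is separated from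
its complement by `γ > 0` (`|Eₖ − Eₗ| ≥ γ` for `k ∈ S ∌ l`). Let `W ∈ L¹` satisfy
`∫ e^{itΔ} W(t) dt = i/Δ` for `|Δ| ≥ γ` (`exists_spectralFlowWeight`) and
`D = ∫ W(t) • τ_t^{H_{s₀}}(X) dt`. Then `P' = i[D, P(s₀)]`.
Matrix elements: differentiating `H_s P_s = P_s H_s` and `P_s² = P_s` gives
`(Eₖ − Eₗ) P'ₖₗ = (𝟙ₖ − 𝟙ₗ) Xₖₗ` and `P'ₖₗ = 0` on same-side pairs, while
`(i[D,P])ₖₗ = i(𝟙ₗ − 𝟙ₖ) Ŵ(Eₖ − Eₗ) Xₖₗ` with `Ŵ(Δ) = i/Δ` across the gap.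
Bachmann–Michalakis–Nachtergaele–Sims, CMP **309** (2012) 835 = arXiv:1102.0842, §2,
Proposition 2.4 and its proof (p. 6: "`i ∫ dt w_γ(t) ∫₀ᵗ du e^{±iu(λ−μ)} = ∓ 1/(λ−μ)`", whence
`∂_s P(s) = i[D(s), P(s)]`); Hastings–Wen (2005). [folklore] -/
theorem hasDerivAt_proj_eq_comm_hastingsGenerator {H₀ X : Matrix n n ℂ}
    {P : ℝ → Matrix n n ℂ} {s₀ : ℝ} {P' : Matrix n n ℂ} (hPd : HasDerivAt P P' s₀)
    (hcomm : ∀ᶠ s : ℝ in 𝓝 s₀, (H₀ + s • X) * P s = P s * (H₀ + s • X))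
    (hidem : ∀ᶠ s : ℝ in 𝓝 s₀, P s * P s = P s)
    (hH : (H₀ + s₀ • X).IsHermitian) (S : Finset n)
    (hPs₀ : P s₀ = projMatrix (Submodule.span ℂ (Set.range fun i : S => hH.eigenvectorBasis i)))
    {γ : ℝ} (hγ : 0 < γ) (hsep : ∀ k ∈ S, ∀ l ∉ S, γ ≤ |hH.eigenvalues k - hH.eigenvalues l|)
    {W : ℝ → ℂ} (hWi : Integrable W)
    (hW : ∀ Δ : ℝ, γ ≤ |Δ| → ∫ t : ℝ, cexp (t * Δ * I) * W t = I / Δ) :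
    P' = I • ((∫ t : ℝ, W t • heisenbergEvolution (H₀ + s₀ • X) t X) * P s₀ -
      P s₀ * ∫ t : ℝ, W t • heisenbergEvolution (H₀ + s₀ • X) t X) := by
  set Hs : ℝ → Matrix n n ℂ := fun s => H₀ + s • X with hHs
  -- (E1) differentiate `H_s P_s = P_s H_s`; (E2) differentiate `P_s² = P_s`
  have hHd : HasDerivAt Hs X s₀ := hasDerivAt_affinePath H₀ X s₀
  have hl : HasDerivAt (fun s => Hs s * P s) (X * P s₀ + Hs s₀ * P') s₀ := hHd.mul hPd
  have hr : HasDerivAt (fun s => P s * Hs s) (P' * Hs s₀ + P s₀ * X) s₀ := hPd.mul hHd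
  have hE1 : X * P s₀ + Hs s₀ * P' = P' * Hs s₀ + P s₀ * X :=
    (hl.congr_of_eventuallyEq (hcomm.mono fun s hs => hs.symm)).unique hr
  have hsq : HasDerivAt (fun s => P s * P s) (P' * P s₀ + P s₀ * P') s₀ := hPd.mul hPd
  have hE2 : P' * P s₀ + P s₀ * P' = P' :=
    (hsq.congr_of_eventuallyEq (hidem.mono fun s hs => hs.symm)).unique hPd
  have hHs₀ : Hs s₀ = H₀ + s₀ • X := rfl
  rw [hHs₀] at hE1
  set Pm : Matrix n n ℂ := projMatrix (Submodule.span ℂ (Set.range fun i : S => hH.eigenvectorBasis i))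
    with hPm
  rw [hPs₀] at hE1 hE2 ⊢
  set D : Matrix n n ℂ := ∫ t : ℝ, W t • heisenbergEvolution (H₀ + s₀ • X) t X with hD
  -- compare matrix elements in the eigenbasis of `H_{s₀}`
  rw [← sub_eq_zero]
  refine eq_zero_of_mulVec_eigenvectorBasis_eq_zero hH fun l => ?_
  refine eq_zero_of_eigenvector_dotProduct_eq_zero hH fun k => ?_
  -- the elementary actions on the eigenbasis
  have hPl : Pm *ᵥ (hH.eigenvectorBasis l : n → ℂ) =
      if l ∈ S then (hH.eigenvectorBasis l : n → ℂ) else 0 :=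
    projMatrix_span_mulVec_eigenvectorBasis hH S l
  have hPk : ∀ v : n → ℂ, star (hH.eigenvectorBasis k : n → ℂ) ⬝ᵥ (Pm *ᵥ v) =
      if k ∈ S then star (hH.eigenvectorBasis k : n → ℂ) ⬝ᵥ v else 0 :=
    eigenvector_dotProduct_projMatrix_mulVec hH S k
  have hHl : (H₀ + s₀ • X) *ᵥ (hH.eigenvectorBasis l : n → ℂ) =
      (hH.eigenvalues l : ℂ) • (hH.eigenvectorBasis l : n → ℂ) := mulVec_eigenvectorBasis_coe hH l
  have hHk : ∀ v : n → ℂ, star (hH.eigenvectorBasis k : n → ℂ) ⬝ᵥ ((H₀ + s₀ • X) *ᵥ v) =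
      (hH.eigenvalues k : ℂ) * (star (hH.eigenvectorBasis k : n → ℂ) ⬝ᵥ v) :=
    eigenvector_dotProduct_mulVec_self hH k
  have hdform : star (hH.eigenvectorBasis k : n → ℂ) ⬝ᵥ (D *ᵥ (hH.eigenvectorBasis l : n → ℂ)) =
      (∫ t : ℝ, cexp (t * (hH.eigenvalues k - hH.eigenvalues l) * I) * W t) *
        (star (hH.eigenvectorBasis k : n → ℂ) ⬝ᵥ (X *ᵥ (hH.eigenvectorBasis l : n → ℂ))) :=
    eigenvector_dotProduct_integral_smul_heisenbergEvolution hH hWi X k l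
  have hne_of : γ ≤ |hH.eigenvalues k - hH.eigenvalues l| →
      ((hH.eigenvalues k : ℂ) - hH.eigenvalues l) ≠ 0 := fun hgap => by
    have : hH.eigenvalues k - hH.eigenvalues l ≠ 0 := fun h => by
      rw [h, abs_zero] at hgap
      exact absurd hgap (not_le.mpr hγ)
    exact_mod_cast this
  -- raw matrix elements of (E1), (E2)
  have h1 := congrArg (fun M : Matrix n n ℂ =>
    star (hH.eigenvectorBasis k : n → ℂ) ⬝ᵥ (M *ᵥ (hH.eigenvectorBasis l : n → ℂ))) hE1
  have h2 := congrArg (fun M : Matrix n n ℂ =>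
    star (hH.eigenvectorBasis k : n → ℂ) ⬝ᵥ (M *ᵥ (hH.eigenvectorBasis l : n → ℂ))) hE2
  dsimp only at h1 h2
  rw [add_mulVec, add_mulVec, dotProduct_add, dotProduct_add, ← mulVec_mulVec, ← mulVec_mulVec,
    ← mulVec_mulVec, ← mulVec_mulVec, hPl, hHl, mulVec_smul, dotProduct_smul, hHk, hPk,
    smul_eq_mul] at h1
  rw [add_mulVec, dotProduct_add, ← mulVec_mulVec, ← mulVec_mulVec, hPl, hPk] at h2
  -- the goal's matrix element
  rw [sub_mulVec, dotProduct_sub, smul_mulVec, dotProduct_smul, sub_mulVec, dotProduct_sub,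
    ← mulVec_mulVec, ← mulVec_mulVec, hPl, hPk, smul_eq_mul]
  -- abbreviate the scalars
  set p : ℂ := star (hH.eigenvectorBasis k : n → ℂ) ⬝ᵥ (P' *ᵥ (hH.eigenvectorBasis l : n → ℂ))
    with hp
  set a : ℂ := star (hH.eigenvectorBasis k : n → ℂ) ⬝ᵥ (X *ᵥ (hH.eigenvectorBasis l : n → ℂ))
    with ha
  by_cases hk : k ∈ S <;> by_cases hl' : l ∈ S
  · -- both inside: `p = 0`
    simp only [if_pos hk, if_pos hl'] at h2 ⊢
    rw [sub_self, mul_zero, sub_zero]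
    linear_combination h2
  · -- `k ∈ S`, `l ∉ S`
    simp only [if_pos hk, if_neg hl', mulVec_zero, dotProduct_zero] at h1 ⊢
    have hgap := hsep k hk l hl'
    have hne := hne_of hgap
    rw [hdform]
    simp only [← Complex.ofReal_sub]
    rw [hW _ hgap]
    push_cast
    have hpval : p = a / ((hH.eigenvalues k : ℂ) - hH.eigenvalues l) := by
      field_simp
      linear_combination h1
    rw [hpval]
    field_simp
    linear_combination a * Complex.I_mul_I
  · -- `k ∉ S`, `l ∈ S`
    simp only [if_neg hk, if_pos hl'] at h1 ⊢
    have hgap := hsep l hl' k hk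
    rw [abs_sub_comm] at hgap
    have hne := hne_of hgap
    rw [hdform]
    simp only [← Complex.ofReal_sub]
    rw [hW _ hgap]
    push_cast
    have hpval : p = -a / ((hH.eigenvalues k : ℂ) - hH.eigenvalues l) := by
      field_simp
      linear_combination h1
    rw [hpval]
    field_simp
    linear_combination (-a) * Complex.I_mul_I
  · -- both outside: `p = 0`
    simp only [if_neg hk, if_neg hl', mulVec_zero, dotProduct_zero] at h2 ⊢
    rw [sub_self, mul_zero, sub_zero]
    linear_combination (-1 : ℂ) * h2

end ProjDeriv

end Literature.MathematicalPhysics.QuantumLattice
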